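/-
Origin: expansion seat `planner-pub-hodgecm-prl1-g3-0`, handover #7 2026-08-18T06:18:50Z (`HOME/pub-hodgecm-prl1-g3/lean/Prl1g3/DiscretePart.lean`, md5 cdad8a89, 208 lines);
landed by the gen-6 packager in gate run 24 as `HodgeCM/Automorphic/DiscretePart.lean` (import ^import Prl1g3\.→import HodgeCM.Automorphic. ×1).
-/
/-
Copyright: HodgeCMPerL adjudication package. WIP seat prl1-g3 (planner-pub-hodgecm-prl1-g3-0), file 7.
-/
import Summits.HodgeConjecture.HodgeCM.Automorphic.DiscreteDecomposition

/-!
# The discrete part of a unitary representation decomposes discretely — the `G_U`-side field `hatτ_complete`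

After files 1–6 of this seat and pv06-g3's `HodgeCM.PerL34.CompactApprox` / `CompactApproxBridge` (gate run 24),
every analytic hypothesis of the representation carrier `RepCoreCarrier.Analytic` on the `L²([U(W)])` side is a
theorem over the honest model (`analyticK_of_hatτ_complete`), and the ONE remaining field is the `G_U`-side
completeness

  `hatτ_complete : (⨆ j, C.hatτ j).topologicalClosure = ⊤`                                   (AX1b(a)).

In PerL v5 (ll. 264–268) AX1b(a) is the discrete decomposition, into `τ`-isotypic pieces, of the DISCRETE
spectrum of `G_U = GU(2,1)`: the quotient `[G_U]` is NOT compact, `L²([G_U])` has continuous spectrum, and the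
statement is about `L²_disc([G_U])` — by definition the closed span of the irreducible closed invariant subspaces.
For that space the completeness is not an extra input: it is a theorem of Hilbert-space representation theory,
proved here in full generality.

For ANY unitary representation `R : G →* (H →L[ℂ] H)` on a complex Hilbert space:

* `discPart R` — the discrete part `(⨆ V : Irr R, V).topologicalClosure`, a closed invariant subspace
  (`isClosed_discPart`, `discPart_invariant`), and `discRep R : G →* (discPart R →L[ℂ] discPart R)` the restricted
  representation, unitary (`isUnitaryRep_discRep`);
* `isIrreducible_comap_discPart` — every irreducible closed invariant subspace `V` of `R` (necessarily
  `V ≤ discPart R`), pulled back along the inclusion, is an irreducible closed invariant subspace of `discRep R`;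
* **`discreteDecomp_discRep : (⨆ W : Irr (discRep R), W).topologicalClosure = ⊤`** and
  **`iSup_isotypic_discRep : (⨆ c, isotypic (discRep R) c).topologicalClosure = ⊤`** — the discrete part is the
  Hilbert sum of its isotypic components (with file 1's `iSup_isotypic_eq`).  No hypothesis beyond unitarity.

Carrier corollary (`RepCoreCarrier.hatτ_complete_of_discPart`): a core carrier whose `G_U`-side Hilbert space is
MODELLED as `HG := discPart R_U` for a unitary representation `R_U` of `G_U(𝔸)` (e.g. right translation on
`L²([G_U])`), with `SigIdxG := IsoClass (discRep R_U)` and `hatτ := isotypic (discRep R_U)` — the `τ`-isotypic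
decomposition PerL means, not the vacuous `⊤` — satisfies `hatτ_complete`; every `hatτ j` is moreover closed and
`discRep R_U`-invariant (file 1).  Together with `CompactApprox.analyticK_of_hatτ_complete` (pv06-g3) this leaves
NO analytic hypothesis in `RepCoreCarrier.Analytic` over the pair of models (compact quotient on the `U(W)` side,
discrete part on the `G_U` side); what remains of the realisation is the torus side, `ThetaModel.Inputs`, and the
dictionary identifying the adelic quotients with the models.

Kernel-checked throughout, no new axioms; imports this seat's `DiscreteDecomposition` (run 24) only.
-/

noncomputable section

open scoped Topology InnerProductSpace

namespace HodgeCM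
namespace RepDecomp

open HodgeCM.PerL34 HodgeCM.PerL34.Spectral

variable {H : Type*} [NormedAddCommGroup H] [InnerProductSpace ℂ H]
variable {G : Type*} [Group G] (R : G →* (H →L[ℂ] H))

/-! ## 1. The discrete part and the restricted representation -/

/-- The **discrete part** of `R`: the closed span of the irreducible closed `R`-invariant subspaces. -/
def discPart : Submodule ℂ H := (⨆ V : Irr R, (V.1 : Submodule ℂ H)).topologicalClosure

/-- (Ported verbatim from the HodgeCMPerL package; no docstring in the source.) -/
theorem isClosed_discPart : IsClosed (discPart R : Set H) := Submodule.isClosed_topologicalClosure _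

/-- (Ported verbatim from the HodgeCMPerL package; no docstring in the source.) -/
theorem discPart_invariant : Invariant R (discPart R) :=
  (Invariant.iSup fun V : Irr R => V.2.invariant).topologicalClosure

/-- (Ported verbatim from the HodgeCMPerL package; no docstring in the source.) -/
theorem le_discPart (V : Irr R) : (V.1 : Submodule ℂ H) ≤ discPart R :=
  (le_iSup (fun W : Irr R => (W.1 : Submodule ℂ H)) V).trans (Submodule.le_topologicalClosure _)

/-- (Ported verbatim from the HodgeCMPerL package; no docstring in the source.) -/
instance [CompleteSpace H] : CompleteSpace (discPart R) := (isClosed_discPart R).completeSpace_coe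

/-- The representation restricted to its discrete part. -/
def discRep : G →* (discPart R →L[ℂ] discPart R) := restrictHom (discPart R) (discPart_invariant R)

/-- (Ported verbatim from the HodgeCMPerL package; no docstring in the source.) -/
@[simp] theorem coe_discRep_apply (g : G) (v : discPart R) : ((discRep R g v : discPart R) : H) = R g v := rfl

variable {R}

/-- (Ported verbatim from the HodgeCMPerL package; no docstring in the source.) -/
theorem isUnitaryRep_discRep (hR : IsUnitaryRep R) : IsUnitaryRep (discRep R) :=
  isUnitaryRep_restrictHom hR _ _

/-! ## 2. Irreducibles pull back to irreducibles -/

/-- The inclusion `discPart R → H` is a closed embedding. -/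
theorem isClosedEmbedding_discPart_subtype :
    Topology.IsClosedEmbedding (Subtype.val : discPart R → H) :=
  (isClosed_discPart R).isClosedEmbedding_subtypeVal

variable (R) in
/-- Pull-back of a subspace of `H` to the discrete part. -/
abbrev pull (V : Submodule ℂ H) : Submodule ℂ (discPart R) := V.comap (discPart R).subtype

/-- (Ported verbatim from the HodgeCMPerL package; no docstring in the source.) -/
theorem map_pull_eq {V : Submodule ℂ H} (hV : V ≤ discPart R) :
    (pull R V).map (discPart R).subtype = V := by
  rw [Submodule.map_comap_subtype, inf_eq_right.mpr hV]

/-- (Ported verbatim from the HodgeCMPerL package; no docstring in the source.) -/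
theorem isClosed_pull {V : Submodule ℂ H} (hV : IsClosed (V : Set H)) :
    IsClosed (pull R V : Set (discPart R)) :=
  hV.preimage continuous_subtype_val

/-- (Ported verbatim from the HodgeCMPerL package; no docstring in the source.) -/
theorem pull_invariant {V : Submodule ℂ H} (hV : Invariant R V) : Invariant (discRep R) (pull R V) :=
  fun g v hv => by
    change R g (v : H) ∈ V
    exact hV g _ hv

/-- A closed `discRep`-invariant subspace of the discrete part pushes forward to a closed `R`-invariant subspace. -/
theorem isClosed_map_subtype {W : Submodule ℂ (discPart R)} (hW : IsClosed (W : Set (discPart R))) :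
    IsClosed (W.map (discPart R).subtype : Set H) := by
  rw [Submodule.map_coe]
  exact isClosedEmbedding_discPart_subtype.isClosedMap _ hW

/-- (Ported verbatim from the HodgeCMPerL package; no docstring in the source.) -/
theorem map_subtype_invariant {W : Submodule ℂ (discPart R)} (hW : Invariant (discRep R) W) :
    Invariant R (W.map (discPart R).subtype) := by
  rintro g _ ⟨w, hw, rfl⟩
  exact ⟨discRep R g w, hW g w hw, rfl⟩

/-- **Irreducibles of `R` pull back to irreducibles of `discRep R`.** -/
theorem isIrreducible_pull (V : Irr R) : IsIrreducible (discRep R) (pull R V.1) where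
  isClosed := isClosed_pull V.2.isClosed
  invariant := pull_invariant V.2.invariant
  ne_bot := by
    intro h
    apply V.2.ne_bot
    rw [← map_pull_eq (le_discPart R V), h, Submodule.map_bot]
  irred W hWle hWc hWinv := by
    have hinj : Function.Injective (discPart R).subtype := Subtype.val_injective
    rcases V.2.irred (W.map (discPart R).subtype)
        ((Submodule.map_mono hWle).trans (map_pull_eq (le_discPart R V)).le)
        (isClosed_map_subtype hWc) (map_subtype_invariant hWinv) with h | h
    · left
      rw [← Submodule.comap_map_eq_of_injective hinj W, h, Submodule.comap_bot, Submodule.ker_subtype]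
    · right
      rw [← Submodule.comap_map_eq_of_injective hinj W, h]

/-- The pulled-back irreducible, as an element of `Irr (discRep R)`. -/
def pullIrr (V : Irr R) : Irr (discRep R) := ⟨pull R V.1, isIrreducible_pull V⟩

/-! ## 3. The discrete part decomposes discretely -/

/-- **The discrete part of a unitary representation is the closed span of its irreducible closed invariant
subspaces** (no hypothesis). -/
theorem discreteDecomp_discRep :
    (⨆ W : Irr (discRep R), (W.1 : Submodule ℂ (discPart R))).topologicalClosure = ⊤ := by
  rw [eq_top_iff]
  rintro x -
  set S : Submodule ℂ (discPart R) := ⨆ W : Irr (discRep R), (W.1 : Submodule ℂ (discPart R)) with hS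
  -- the span of the irreducibles of `R` lies in the image of `S`
  have hle : (⨆ V : Irr R, (V.1 : Submodule ℂ H)) ≤ S.map (discPart R).subtype := by
    refine iSup_le fun V => ?_
    rw [← map_pull_eq (le_discPart R V)]
    exact Submodule.map_mono (le_iSup (fun W : Irr (discRep R) => (W.1 : Submodule ℂ (discPart R))) (pullIrr V))
  -- `x ∈ closure (⨆ V) ⊆ closure (map S)`, read in the subtype topology
  have hx0 : (x : H) ∈ closure ((⨆ V : Irr R, (V.1 : Submodule ℂ H) : Submodule ℂ H) : Set H) := x.2
  have hx : (x : H) ∈ closure ((S.map (discPart R).subtype : Submodule ℂ H) : Set H) :=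
    closure_mono (fun y hy => hle hy) hx0
  rw [← SetLike.mem_coe, Submodule.topologicalClosure_coe, closure_subtype]
  rwa [Submodule.map_coe, Submodule.coe_subtype] at hx

/-- … hence the Hilbert sum of its isotypic components. -/
theorem iSup_isotypic_discRep : (⨆ c, isotypic (discRep R) c).topologicalClosure = ⊤ := by
  rw [iSup_isotypic_eq]
  exact discreteDecomp_discRep

end RepDecomp

/-! ## 4. The carrier corollary: `hatτ_complete` over the discrete-part model -/

namespace RepCoreCarrier

open HodgeCM.PerL34 HodgeCM.PerL34.Spectral

variable {H HU CG G GU SK : Type}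
variable [NormedAddCommGroup H] [InnerProductSpace ℂ H] [CompleteSpace H]
variable [NormedAddCommGroup HU] [InnerProductSpace ℂ HU] [CompleteSpace HU]
variable [NormedAddCommGroup CG] [NormedSpace ℂ CG]
variable [Group G] [TopologicalSpace G] [TopologicalSpace SK] [Group GU]
variable (RU : GU →* (HU →L[ℂ] HU))

/-- **`hatτ_complete` IS A THEOREM over the discrete-part model.**  For a core carrier whose `G_U`-side space is the
discrete part `RepDecomp.discPart R_U` of a unitary representation `R_U` of (a model of) `G_U(𝔸)` and whose
`hatτ` is the isotypic decomposition of the restricted representation, the field `hatτ_complete` of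
`RepCoreCarrier.Analytic` / `AnalyticK` / `AnalyticL2` / `AnalyticD` holds. -/
theorem hatτ_complete_of_discPart
    (C : RepCoreCarrier H (RepDecomp.discPart RU) CG G SK (RepDecomp.IsoClass (RepDecomp.discRep RU)))
    (hτ : C.hatτ = RepDecomp.isotypic (RepDecomp.discRep RU)) :
    (⨆ j, C.hatτ j).topologicalClosure = ⊤ := by
  rw [hτ]
  exact RepDecomp.iSup_isotypic_discRep

/-- … and every `hatτ j` is closed and `discRep R_U`-invariant in that model (file 1), for the record. -/
theorem hatτ_invariant_of_discPart
    (C : RepCoreCarrier H (RepDecomp.discPart RU) CG G SK (RepDecomp.IsoClass (RepDecomp.discRep RU)))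
    (hτ : C.hatτ = RepDecomp.isotypic (RepDecomp.discRep RU)) (j : RepDecomp.IsoClass (RepDecomp.discRep RU)) :
    RepDecomp.Invariant (RepDecomp.discRep RU) (C.hatτ j) := by
  rw [hτ]
  exact RepDecomp.isotypic_invariant j

/-- Hence, over the discrete-part model, `AnalyticK` needs only the two `U(W)`-side fields. -/
theorem analyticK_of_discPart
    (C : RepCoreCarrier H (RepDecomp.discPart RU) CG G SK (RepDecomp.IsoClass (RepDecomp.discRep RU)))
    (hτ : C.hatτ = RepDecomp.isotypic (RepDecomp.discRep RU))
    (hR : IsUnitaryRep C.R) (hK : RepDecomp.HasCompactApprox C.R) : C.AnalyticK where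
  R_unitary := hR
  compactApprox := hK
  hatτ_complete := hatτ_complete_of_discPart RU C hτ

end RepCoreCarrier
end HodgeCM
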